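import Summits.HodgeConjecture.CorCM.Model.Universe2Facts
import Summits.HodgeConjecture.CorCM.CycleClassFacts
import Summits.HodgeConjecture.CorCM.GysinSurface
import Summits.HodgeConjecture.CorCM.KunnethDegreeOne
import HarnessLib

/-!
# The second model universe `Model2.universe₂` has the FULL 28-field `ModelAxioms` of the model of record
# (`Model.universeOf`), plus the guarded domination binder — transfer and generic fields

Cell `pub-hodgecm2` (COR-CM), seat model-2 (gen 2).  The iso-complete universe `universe₂ hHD hI hU h₃`
(`Model/Universe2.lean`) reads every CODE-BUILT variety — the CM abelian varieties `A_{(K,Φ)}` = `.cm (Model.cmCode K Φ)`,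
the Picard modular surfaces `.pms (Model.pmsCode …)`, their products (`prod4`, `cmProd`) — by the SAME schemes, the same
Betti carriers, pull-backs, cup products, traces, algebraic classes, Hodge structures and CM actions as the model of
record `Model.universeOf hHD hI hU h₃`.  Consequently:

* §1 TRANSFER: every `ModelAxioms` field (and every period statement) that quantifies only over code-built varieties
  is LITERALLY THE SAME PROPOSITION in the two universes (`Iff.rfl`): `eigenLine`, `alphaLine`, `H1_rank`, `cmEnd`,
  `conjIsogeny`, `deg_diag`, `algDuality`, `weilLine_rank`, `weilLine_hodge`, `H4_span`, `pms_dim`; `PerL`, `PerL44`,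
  `PeriodThmF`, `PeriodNV` (the last four already in `Model/Universe2.lean`).
* §2 GENERIC: every field that quantifies over ALL varieties of the universe holds at the `IsoComplete` codes by the
  scheme-level theorems of the tree (model-1 `CorCM/CycleClassFacts`, `CorCM/GysinSurface`; p2 `CorCM/KunnethDegreeOne`):
  `alg_le_hodge`, `pull_alg`, `cup_alg`, `lefschetz11`, `gysin_surface`, `kunneth1` (and, in `Model/Universe2Facts.lean`,
  `pull_id/comp/cup/hodge`, `cup2_hodge`, `tr_degree`, `cup_comm1`, `cup_interchange`, `lift`).
* §3 ASSEMBLY `modelAxioms₂_of`: `(Model.universeOf …).ModelAxioms` and M14 of `universe₂` give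
  `(universe₂ …).ModelAxioms` — the only fields NOT read off the model of record being M11 `cmAV` (intrinsic CM
  predicate, `universe₂_fact_cmAV`) and M14 `cmDominated` (`Model/Universe2Facts.lean`); `modelAxioms₂_of_riemann`:
  the same modulo Riemann's theorem `hR` (row B02) only.

So the referee's comparison of the two constructions is EXACT: same rows, same displayed binder `hR`; construction 2
consumes the Shimura–Taniyama structure theorem once, inside M14 (guarded, from `hR`), and its E-term junction
`universe₂.HC_CM ↔ CMAbelianHodge` is kernel (`Model2.HC_CM_iff_CMAbelianHodge`), where construction 1 consumes it at
the junction (`DictionaryA3`, binder B03 `dom`).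
-/

noncomputable section

namespace Summit.HodgeConjecture.CorCM

namespace Model2

open Literature.NumberTheory.Automorphic
open Literature.NumberTheory.Automorphic.PicardCM (BallQuotientUniformisedDatum CMAbelianVarietyRealised)
open Literature.AlgebraicGeometry.HodgeTheory
open Literature.AlgebraicGeometry.Motives (CMType AbelianVariety)


/-! ### §1 Transfer: code-only fields are the same proposition in `universe₂` and `universeOf` -/

/-- M12/M13-type transfer: `Fact_eigenLine` is read identically in the two model universes. [folklore] -/
theorem fact_eigenLine_iff (hHD : exists_isReal_hodgeModel) (hI : hodgePQ_independent_of_hodgeModel)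
    (hU : BallQuotientUniformisedDatum) (h₃ : CMAbelianVarietyRealised) :
    (universe₂ hHD hI hU h₃).Fact_eigenLine ↔ (Model.universeOf hHD hI hU h₃).Fact_eigenLine := Iff.rfl

/-- `Fact_alphaLine` (the CM-type condition) is read identically in the two model universes. [folklore] -/
theorem fact_alphaLine_iff (hHD : exists_isReal_hodgeModel) (hI : hodgePQ_independent_of_hodgeModel)
    (hU : BallQuotientUniformisedDatum) (h₃ : CMAbelianVarietyRealised) :
    (universe₂ hHD hI hU h₃).Fact_alphaLine ↔ (Model.universeOf hHD hI hU h₃).Fact_alphaLine := Iff.rfl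

/-- `Fact_H1_rank` is read identically in the two model universes. [folklore] -/
theorem fact_H1_rank_iff (hHD : exists_isReal_hodgeModel) (hI : hodgePQ_independent_of_hodgeModel)
    (hU : BallQuotientUniformisedDatum) (h₃ : CMAbelianVarietyRealised) :
    (universe₂ hHD hI hU h₃).Fact_H1_rank ↔ (Model.universeOf hHD hI hU h₃).Fact_H1_rank := Iff.rfl

/-- `Fact_cmEnd` (CM by the maximal order) is read identically in the two model universes. [folklore] -/
theorem fact_cmEnd_iff (hHD : exists_isReal_hodgeModel) (hI : hodgePQ_independent_of_hodgeModel)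
    (hU : BallQuotientUniformisedDatum) (h₃ : CMAbelianVarietyRealised) :
    (universe₂ hHD hI hU h₃).Fact_cmEnd ↔ (Model.universeOf hHD hI hU h₃).Fact_cmEnd := Iff.rfl

/-- `Fact_conjIsogeny` (conjugate types are antilinearly isogenous) is read identically in the two model
universes. [folklore] -/
theorem fact_conjIsogeny_iff (hHD : exists_isReal_hodgeModel) (hI : hodgePQ_independent_of_hodgeModel)
    (hU : BallQuotientUniformisedDatum) (h₃ : CMAbelianVarietyRealised) :
    (universe₂ hHD hI hU h₃).Fact_conjIsogeny ↔ (Model.universeOf hHD hI hU h₃).Fact_conjIsogeny := Iff.rfl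

/-- `Fact_deg_diag` (degree of the diagonal action on the corner product) is read identically in the two model
universes. [folklore] -/
theorem fact_deg_diag_iff (hHD : exists_isReal_hodgeModel) (hI : hodgePQ_independent_of_hodgeModel)
    (hU : BallQuotientUniformisedDatum) (h₃ : CMAbelianVarietyRealised) :
    (universe₂ hHD hI hU h₃).Fact_deg_diag ↔ (Model.universeOf hHD hI hU h₃).Fact_deg_diag := Iff.rfl

/-- `Fact_algDuality` (Lieberman: algebraic self-duality of the corner product) is read identically in the two
model universes. [folklore] -/
theorem fact_algDuality_iff (hHD : exists_isReal_hodgeModel) (hI : hodgePQ_independent_of_hodgeModel)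
    (hU : BallQuotientUniformisedDatum) (h₃ : CMAbelianVarietyRealised) :
    (universe₂ hHD hI hU h₃).Fact_algDuality ↔ (Model.universeOf hHD hI hU h₃).Fact_algDuality := Iff.rfl

/-- `Fact_weilLine_rank` (the Weil line is a `K`-line) is read identically in the two model universes. [folklore] -/
theorem fact_weilLine_rank_iff (hHD : exists_isReal_hodgeModel) (hI : hodgePQ_independent_of_hodgeModel)
    (hU : BallQuotientUniformisedDatum) (h₃ : CMAbelianVarietyRealised) :
    (universe₂ hHD hI hU h₃).Fact_weilLine_rank ↔ (Model.universeOf hHD hI hU h₃).Fact_weilLine_rank := Iff.rfl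

/-- `Fact_weilLine_hodge` (Weil classes of a face are Hodge `(2,2)`) is read identically in the two model
universes. [folklore] -/
theorem fact_weilLine_hodge_iff (hHD : exists_isReal_hodgeModel) (hI : hodgePQ_independent_of_hodgeModel)
    (hU : BallQuotientUniformisedDatum) (h₃ : CMAbelianVarietyRealised) :
    (universe₂ hHD hI hU h₃).Fact_weilLine_hodge ↔ (Model.universeOf hHD hI hU h₃).Fact_weilLine_hodge := Iff.rfl

/-- `Fact_H4_span` (`H⁴` of the corner product is spanned by four-fold cups) is read identically in the two
model universes. [folklore] -/
theorem fact_H4_span_iff (hHD : exists_isReal_hodgeModel) (hI : hodgePQ_independent_of_hodgeModel)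
    (hU : BallQuotientUniformisedDatum) (h₃ : CMAbelianVarietyRealised) :
    (universe₂ hHD hI hU h₃).Fact_H4_span ↔ (Model.universeOf hHD hI hU h₃).Fact_H4_span := Iff.rfl

/-- `PmsDimTwo` is read identically in the two model universes. [folklore] -/
theorem pmsDimTwo_iff (hHD : exists_isReal_hodgeModel) (hI : hodgePQ_independent_of_hodgeModel)
    (hU : BallQuotientUniformisedDatum) (h₃ : CMAbelianVarietyRealised) :
    (universe₂ hHD hI hU h₃).PmsDimTwo ↔ (Model.universeOf hHD hI hU h₃).PmsDimTwo := Iff.rfl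

/-! ### §2 Generic fields at the `IsoComplete` codes (scheme-level tree theorems) -/

/-- **`Fact_alg_le_hodge`** for `universe₂`: rational algebraic classes are Hodge classes
(model-1's `Model.ratAlgebraicClasses_le_hodgeClasses`). [cite: VoisinHodgeI2002, Prop. 11.20] -/
theorem universe₂_fact_alg_le_hodge (hHD : exists_isReal_hodgeModel) (hI : hodgePQ_independent_of_hodgeModel)
    (hU : BallQuotientUniformisedDatum) (h₃ : CMAbelianVarietyRealised) : (universe₂ hHD hI hU h₃).Fact_alg_le_hodge :=
  fun X p ↦ Model.ratAlgebraicClasses_le_hodgeClasses hHD hI (IsoComplete.Var.isSmoothProjective hU h₃ X) p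

/-- **`Fact_pull_alg`** for `universe₂`: pull-backs preserve rational algebraic classes
(model-1's `Model.ratAlgebraicClasses_map_pull_le`). [folklore] -/
theorem universe₂_fact_pull_alg (hHD : exists_isReal_hodgeModel) (hI : hodgePQ_independent_of_hodgeModel)
    (hU : BallQuotientUniformisedDatum) (h₃ : CMAbelianVarietyRealised) : (universe₂ hHD hI hU h₃).Fact_pull_alg :=
  fun X Y f p ↦ Model.ratAlgebraicClasses_map_pull_le (IsoComplete.Var.isSmoothProjective hU h₃ Y)
    (IsoComplete.Var.isSmoothProjective hU h₃ X) f p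

/-- **`Fact_cup_alg`** for `universe₂`: the cup product of two rational divisor classes is algebraic
(model-1's `Model.cup_mem_ratAlgebraicClasses_two`). [folklore] -/
theorem universe₂_fact_cup_alg (hHD : exists_isReal_hodgeModel) (hI : hodgePQ_independent_of_hodgeModel)
    (hU : BallQuotientUniformisedDatum) (h₃ : CMAbelianVarietyRealised) : (universe₂ hHD hI hU h₃).Fact_cup_alg :=
  fun X _ _ hx hy ↦ Model.cup_mem_ratAlgebraicClasses_two (IsoComplete.Var.isSmoothProjective hU h₃ X) hx hy

/-- **`Fact_Lefschetz11`** for `universe₂`: Lefschetz (1,1) (model-1's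
`Model.hodgeClasses_one_le_ratAlgebraicClasses`). [cite: VoisinHodgeI2002, Thm. 11.30] -/
theorem universe₂_fact_lefschetz11 (hHD : exists_isReal_hodgeModel) (hI : hodgePQ_independent_of_hodgeModel)
    (hU : BallQuotientUniformisedDatum) (h₃ : CMAbelianVarietyRealised) : (universe₂ hHD hI hU h₃).Fact_Lefschetz11 :=
  fun X ↦ Model.hodgeClasses_one_le_ratAlgebraicClasses hHD hI (IsoComplete.Var.isSmoothProjective hU h₃ X)

/-- **`Fact_gysin_surface`** for `universe₂`: the projection formula for a surface mapping to `X`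
(model-1's `Model.exists_gysin_surface`). [folklore] -/
theorem universe₂_fact_gysin_surface (hHD : exists_isReal_hodgeModel) (hI : hodgePQ_independent_of_hodgeModel)
    (hU : BallQuotientUniformisedDatum) (h₃ : CMAbelianVarietyRealised) : (universe₂ hHD hI hU h₃).Fact_gysin_surface :=
  fun S X f hS ↦ Model.exists_gysin_surface (IsoComplete.Var.isSmoothProjective hU h₃ S) hS
    (IsoComplete.Var.isSmoothProjective hU h₃ X) f

/-- **`Fact_kunneth1`** for `universe₂`: Künneth in degree one (p2's `Model.kunneth_one_bijective`).
[cite: VoisinHodgeI2002, Thm. 11.38] -/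
theorem universe₂_fact_kunneth1 (hHD : exists_isReal_hodgeModel) (hI : hodgePQ_independent_of_hodgeModel)
    (hU : BallQuotientUniformisedDatum) (h₃ : CMAbelianVarietyRealised) : (universe₂ hHD hI hU h₃).Fact_kunneth1 :=
  fun X Y ↦ Model.kunneth_one_bijective (IsoComplete.Var.isSmoothProjective hU h₃ X)
    (IsoComplete.Var.isSmoothProjective hU h₃ Y)

/-! ### §3 Assembly: `universe₂.ModelAxioms` from the model of record's `ModelAxioms` and M14 of `universe₂` -/

/-- **The second model universe satisfies the 28 model axioms** whenever the model of record does, granted ITS OWN M14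
`Fact_cmDominated` (see `Model/Universe2Facts.lean`: from the guarded binder, or modulo Riemann's theorem only): the
eleven code-only fields are transported VERBATIM from `M` (§1, definitional), the fifteen generic fields are the tree's
scheme-level theorems at the `IsoComplete` codes (§2 and `Model/Universe2Facts.lean`), M11 `cmAV` is intrinsic.
[folklore] -/
theorem modelAxioms₂_of (hHD : exists_isReal_hodgeModel) (hI : hodgePQ_independent_of_hodgeModel)
    (hU : BallQuotientUniformisedDatum) (h₃ : CMAbelianVarietyRealised) (M : (Model.universeOf hHD hI hU h₃).ModelAxioms)
    (h14 : (universe₂ hHD hI hU h₃).Fact_cmDominated) :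
    (universe₂ hHD hI hU h₃).ModelAxioms where
  pull_id := universe₂_fact_pull_id hHD hI hU h₃
  pull_comp := universe₂_fact_pull_comp hHD hI hU h₃
  pull_cup := universe₂_fact_pull_cup hHD hI hU h₃
  pull_hodge := universe₂_fact_pull_hodge hHD hI hU h₃
  cup2_hodge := universe₂_fact_cup2_hodge hHD hI hU h₃
  tr_degree := universe₂_fact_tr_degree hHD hI hU h₃
  alg_le_hodge := universe₂_fact_alg_le_hodge hHD hI hU h₃
  pull_alg := universe₂_fact_pull_alg hHD hI hU h₃
  cup_alg := universe₂_fact_cup_alg hHD hI hU h₃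
  lefschetz11 := universe₂_fact_lefschetz11 hHD hI hU h₃
  cmAV := universe₂_fact_cmAV hHD hI hU h₃
  eigenLine := (fact_eigenLine_iff hHD hI hU h₃).2 M.eigenLine
  alphaLine := (fact_alphaLine_iff hHD hI hU h₃).2 M.alphaLine
  cmDominated := h14
  weilLine_rank := (fact_weilLine_rank_iff hHD hI hU h₃).2 M.weilLine_rank
  weilLine_hodge := (fact_weilLine_hodge_iff hHD hI hU h₃).2 M.weilLine_hodge
  pms_dim := universe₂_pmsDimTwo hHD hI hU h₃
  lift := universe₂_fact_lift hHD hI hU h₃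
  cup_comm1 := universe₂_fact_cup_comm1 hHD hI hU h₃
  cup_interchange := universe₂_fact_cup_interchange hHD hI hU h₃
  kunneth1 := universe₂_fact_kunneth1 hHD hI hU h₃
  H1_rank := (fact_H1_rank_iff hHD hI hU h₃).2 M.H1_rank
  H4_span := (fact_H4_span_iff hHD hI hU h₃).2 M.H4_span
  cmEnd := (fact_cmEnd_iff hHD hI hU h₃).2 M.cmEnd
  conjIsogeny := (fact_conjIsogeny_iff hHD hI hU h₃).2 M.conjIsogeny
  gysin_surface := universe₂_fact_gysin_surface hHD hI hU h₃
  deg_diag := (fact_deg_diag_iff hHD hI hU h₃).2 M.deg_diag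
  algDuality := (fact_algDuality_iff hHD hI hU h₃).2 M.algDuality

/-- **`universe₂.ModelAxioms` from the model of record's, MODULO RIEMANN'S THEOREM ONLY** (M14 of `universe₂` by
`universe₂_fact_cmDominated_of_riemann`; `hR` = row B02, a displayed binder of `HC_CM_of_PerLFace`).
[cite: DeligneMilne1982Tannakian, §6 Thm. 6.20 (Riemann), print p. 212] -/
theorem modelAxioms₂_of_riemann (hHD : exists_isReal_hodgeModel) (hI : hodgePQ_independent_of_hodgeModel)
    (hU : BallQuotientUniformisedDatum) (h₃ : CMAbelianVarietyRealised) (M : (Model.universeOf hHD hI hU h₃).ModelAxioms)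
    (hR : DeligneMilne1982_Thm_6_20_full) : (universe₂ hHD hI hU h₃).ModelAxioms :=
  modelAxioms₂_of hHD hI hU h₃ M (universe₂_fact_cmDominated_of_riemann hHD hI hU h₃ hR)

/-- **The same over the cited records (ii-a), (iii)**: `picardCMUniverse₂.ModelAxioms` from `picardCMUniverse.ModelAxioms`
and Riemann's theorem (definitionally the previous theorem at `hU := ballQuotientUniformisedDatum_of h₁`). [folklore] -/
theorem picardCMUniverse₂_modelAxioms_of_riemann (hHD : exists_isReal_hodgeModel) (hI : hodgePQ_independent_of_hodgeModel) (h₃ : CMAbelianVarietyRealised) (h₁ : PicardCM.BallQuotientUniformised)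
    (M : (Model.picardCMUniverse hHD hI h₁ h₃).ModelAxioms) (hR : DeligneMilne1982_Thm_6_20_full) :
    (picardCMUniverse₂ hHD hI h₁ h₃).ModelAxioms :=
  modelAxioms₂_of_riemann hHD hI _ h₃ M hR

end Model2

end Summit.HodgeConjecture.CorCM

end
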